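import Literature.Computability.AlgebraicComplexity.GlobalStageThreeRegions
import Literature.Computability.AlgebraicComplexity.CertifiedEntropyNumerics
import HarnessLib

/-!
# The exponent of a region of the global stage at rational data: closed form and kernel certificate
(Vassilevska Williams–Xu–Xu–Zhou 2024, Prop. 5.1 / Thm. 5.3 at the parameters of §8) — proved

Topic `Literature/Computability/AlgebraicComplexity`.  Thm. 5.3 of Vassilevska Williams–Xu–Xu–Zhou,
*New bounds for matrix multiplication: from alpha to omega* (SODA 2024, arXiv:2307.07970) is in the
tree at fixed types with explicit errors (`GlobalStageThreeRegions.vxxz2024_thm53`, one region: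
`vxxz2024_thm53_regionDatum`; asymptotic form `GlobalStageAsymptotic.vxxz2024_thm53_asymptotic`): a
region datum `D : RegionDatum c n` (joint type `Q`, `∑ Q = n`, a triple of type `Q`, target split
distributions `γ_X, γ_Y, γ_Z`) yields `log₂(κ+1) ≥ n (E(D) − epsLoss c ε) − thm53Err c n` copies of its
`ε`-interface tensor, `E(D) = min{H(α_X) − P_α, H(α_Y) − P_α, H(γ̄_Z) − λ_Z, H(α)}` at `α = Q/n`
(`RegionDatum.exponent`).  §8 of the paper ("we include the code that we used to produce the
parameters and verify that the parameters satisfy all the constraints") evaluates these exponents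
at NUMERICAL parameters `α, γ`.  This file is the bridge from rational parameters to the theorem —
the global-stage part of a kernel-checked §8 certificate — with everything PROVED (the definitions
are the data formats, the closed forms and the Boolean checker):

* `RegionWeights c` — rational data of one region (natural joint weights `W`, `α = W/d`, `d = ∑ W`;
  natural tables `G_X, G_Y, G_Z` of split distributions over a common denominator `g`), its
  kernel-decidable `valid`ity, and **`RegionWeights.datum hv m : RegionDatum c (m·d)`** — the datum of
  joint type `m · W` (so `Q/n = α` exactly for every `m`), a triple of that type (by choice;
  `jointTypeClass_nonempty`) and the split distributions `G/g` (`tableGamma`);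
* the **closed form** `RegionWeights.exponent` of `E` at the rational data — `H(W_X/d)`, `H(W_Y/d)`,
  `H(W/d)`, `max_{D(W/d)} H` on the level support, `H(θ/(dg))` for the natural weights
  `θ(k',σ) = ∑_{i+j+k'=2c} W(i,j,k') G_Z(i,j,k')(σ)` of `γ̄_Z = ∑ α γ_Z` (`thetaWeights`), and
  `λ_Z = ∑_{i=0∨j=0} α(i,j,k) H(γ_{Z,i,j,k}) + ∑_k α(+,+,k) H(γ̄_{Z,+,+,k})` with the natural weights
  `ppGammaWeights k` of `γ̄_{Z,+,+,k}` over `g · W(+,+,k)` (`lambda`) — and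
  **`exponent_datum : (w.datum hv m).exponent = w.exponent`** for every `m ≥ 1` (via the printed
  formulas `targetPairDist_eq_sum_alpha`, `targetLambda_eq_sum_alpha` for `γ̄_Z` and `λ_Z` at an
  `α`-consistent triple, of independent use);
* `ExponentCert c`, **`RegionWeights.check`** and **`le_exponent_of_check : w.check C = true →
  E₀/B ≤ w.exponent`** — a certificate (common denominator `B`; integer numerators of lower bounds for
  `H(α_X), H(α_Y), H(α), H(γ̄_Z)`, of upper bounds for `max_D H` at positive rational dual multipliers
  and for the class entropies entering `λ_Z`; the claimed `E₀`) checked with the kernel certificates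
  of `CertifiedEntropyNumerics.lean` (`entropyGeCheck`, `entropyLeCheck`, `maxEntLeCheck`) and integer
  arithmetic; `check_of_parts` reassembles the check from its conjuncts (at the size of the paper,
  `c = 4`, each conjunct is a separate `decide +kernel` of a few seconds to a minute);
* **`vxxz2024_thm53_certified`** — Thm. 5.3 (one region) at certified rational data: for every
  `m ≥ 1` and `0 ≤ ε ≤ 1`, `inputCopies c (md)` copies of `(CW_q^{⊗c})^{⊗md}` restrict to `κ` copies
  of the `ε`-interface tensor of `w.datum m` with `log₂(κ+1) ≥ md (E₀/B − epsLoss c ε) − thm53Err c (md)`.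

A toy instance at `c = 1` is checked in the kernel at the end of the file.  The other two parts of
the §8 certificate (the constituent stages, Thms. 6.1/6.3, and the final rate inequality of
Algorithm 1, cf. `LaserAlgorithmAssembly.cw5Certificate_of_rates`) are not in this file.

## References

* V. Vassilevska Williams, Y. Xu, Z. Xu, R. Zhou, *New bounds for matrix multiplication: from alpha
  to omega*, SODA 2024, arXiv:2307.07970 (held: `paper:arxiv-2307.07970`): §5 preamble (`α(+,+,k)`,
  `γ̄_Z`, `γ̄_{Z,+,+,k}`, `λ_Z`, `P_α`), Prop. 5.1 (`E₁`), Thm. 5.3, Def. 5.15, §8 (numerical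
  verification; parameters at https://osf.io/7wgh2/). [VassilevskaWilliamsXuXuZhou2024]
* F. Le Gall, *Powers of tensors and fast matrix multiplication*, ISSAC 2014, arXiv:1401.7714, §6
  (verification of numerical solutions at rational points). [LeGall2014]
-/

noncomputable section

open scoped BigOperators
open Finset

namespace Literature.Computability.AlgebraicComplexity

open EntropyCert

/-! ## Tables on `Fin (2c+1)³` read on `ℕ³` -/

section Tables

variable {c : ℕ}

/-- A table on level-`ℓ` index triples `Fin (2c+1)³`, read on `ℕ³` (zero out of range) — the
format of `typeAlpha`. [folklore] -/
def natTable {β : Type*} [Zero β] (T : Fin (2 * c + 1) × Fin (2 * c + 1) × Fin (2 * c + 1) → β) :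
    ℕ × ℕ × ℕ → β := fun ijk =>
  if h : ijk.1 < 2 * c + 1 ∧ ijk.2.1 < 2 * c + 1 ∧ ijk.2.2 < 2 * c + 1 then
    T (⟨ijk.1, h.1⟩, ⟨ijk.2.1, h.2.1⟩, ⟨ijk.2.2, h.2.2⟩) else 0

/-- In range, `natTable T (i,j,k) = T (i,j,k)`. [folklore] -/
theorem natTable_apply_fin {β : Type*} [Zero β] (T : Fin (2 * c + 1) × Fin (2 * c + 1) × Fin (2 * c + 1) → β)
    (i j k : Fin (2 * c + 1)) : natTable T ((i : ℕ), (j : ℕ), (k : ℕ)) = T (i, j, k) := by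
  unfold natTable
  rw [dif_pos ⟨i.isLt, j.isLt, k.isLt⟩]

/-- `typeAlpha n Q = natTable Q / n`. [folklore] -/
theorem typeAlpha_eq_natTable (n : ℕ) (Q : Fin (2 * c + 1) × Fin (2 * c + 1) × Fin (2 * c + 1) → ℕ)
    (ijk : ℕ × ℕ × ℕ) : typeAlpha n Q ijk = ((natTable Q ijk : ℕ) : ℝ) / n := by
  unfold typeAlpha natTable
  split_ifs <;> simp

/-- The split distributions `G/g` of a table of natural weights `G` with common denominator `g`,
read on `ℕ³`. [folklore] -/
def tableGamma (G : Fin (2 * c + 1) × Fin (2 * c + 1) × Fin (2 * c + 1) → (Fin c → Fin 3) → ℕ) (g : ℕ) :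
    ℕ × ℕ × ℕ → (Fin c → Fin 3) → ℝ := fun ijk σ => ((natTable G ijk σ : ℕ) : ℝ) / g

/-- `tableGamma ≥ 0`. [folklore] -/
theorem tableGamma_nonneg (G : Fin (2 * c + 1) × Fin (2 * c + 1) × Fin (2 * c + 1) → (Fin c → Fin 3) → ℕ)
    (g : ℕ) (ijk : ℕ × ℕ × ℕ) (σ : Fin c → Fin 3) : 0 ≤ tableGamma G g ijk σ := by
  unfold tableGamma; positivity

/-- `tableGamma ≤ 1` when `G ≤ g` entrywise. [folklore] -/
theorem tableGamma_le_one {G : Fin (2 * c + 1) × Fin (2 * c + 1) × Fin (2 * c + 1) → (Fin c → Fin 3) → ℕ}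
    {g : ℕ} (hG : ∀ s σ, G s σ ≤ g) (ijk : ℕ × ℕ × ℕ) (σ : Fin c → Fin 3) : tableGamma G g ijk σ ≤ 1 := by
  unfold tableGamma natTable
  split_ifs with h
  · rcases Nat.eq_zero_or_pos g with hg | hg
    · subst hg; simp
    · rw [div_le_one (by exact_mod_cast hg)]
      exact_mod_cast hG _ _
  · simp

end Tables

/-! ## Rational region data -/

/-- **Rational data of one region of the global stage** (in the `Z`-shared orientation of
`RegionDatum`): natural joint weights `W` on level triples (the joint distribution is `α = W/d`,
`d = ∑ W`) and natural tables `G_X, G_Y, G_Z` of the target split distributions with a common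
denominator `g` (`γ_{W,i,j,k} = G_W(i,j,k)/g`). [cite: VassilevskaWilliamsXuXuZhou2024, Prop. 5.1 (the data α, γ) and §8 (numerical parameters)] -/
structure RegionWeights (c : ℕ) where
  /-- joint weights: `α = W / ∑ W` -/
  W : Fin (2 * c + 1) × Fin (2 * c + 1) × Fin (2 * c + 1) → ℕ
  /-- numerators of the target split distributions of the `X`-blocks -/
  GX : Fin (2 * c + 1) × Fin (2 * c + 1) × Fin (2 * c + 1) → (Fin c → Fin 3) → ℕ
  /-- numerators of the target split distributions of the `Y`-blocks -/
  GY : Fin (2 * c + 1) × Fin (2 * c + 1) × Fin (2 * c + 1) → (Fin c → Fin 3) → ℕ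
  /-- numerators of the target split distributions of the (shared) `Z`-blocks -/
  GZ : Fin (2 * c + 1) × Fin (2 * c + 1) × Fin (2 * c + 1) → (Fin c → Fin 3) → ℕ
  /-- common denominator of the split distributions -/
  g : ℕ

namespace RegionWeights

variable {c : ℕ} (w : RegionWeights c)

/-- The total weight `d = ∑ W` (the denominator of `α`). [folklore] -/
def total : ℕ := ∑ s, w.W s

/-- **Validity check** (kernel-decidable): `d > 0`, `g > 0`, `W` supported on the level support
`{i+j+k = 2c}`, and `G_Z ≤ g` entrywise (so `0 ≤ γ_Z ≤ 1`). [folklore] -/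
def valid : Bool :=
  decide (0 < w.total) && decide (0 < w.g) && decide (∀ s, s ∉ levelSupport (2 * c) → w.W s = 0) &&
    decide (∀ s σ, w.GZ s σ ≤ w.g)

/-- Unpacking `valid`. [folklore] -/
theorem valid_iff : w.valid = true ↔
    0 < w.total ∧ 0 < w.g ∧ (∀ s, s ∉ levelSupport (2 * c) → w.W s = 0) ∧ (∀ s σ, w.GZ s σ ≤ w.g) := by
  simp only [valid, Bool.and_eq_true, decide_eq_true_eq]
  tauto

/-- A joint type with `∑ Q = n` is realised. [folklore] -/
theorem jointTypeClass_nonempty {n : ℕ} {Q : Fin (2 * c + 1) × Fin (2 * c + 1) × Fin (2 * c + 1) → ℕ}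
    (hQ : ∑ s, Q s = n) : (jointTypeClass n Q).Nonempty := by
  rw [← Finset.card_pos, card_jointTypeClass n Q hQ]
  exact Nat.multinomial_pos _ _

/-- `∑ m W = m d`. [folklore] -/
theorem sum_mul_W (m : ℕ) : ∑ s, m * w.W s = m * w.total := by
  rw [total, Finset.mul_sum]

/-- **The region datum of size `n = m · d` of rational data**: joint type `Q = m · W` (so that
`Q/n = W/d = α` exactly), a block triple of type `Q` (by choice), and the split distributions `G/g`.
[cite: VassilevskaWilliamsXuXuZhou2024, Prop. 5.1 and Thm. 5.3 (types n·α)] -/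
def datum (hv : w.valid = true) (m : ℕ) : RegionDatum c (m * w.total) where
  Q := fun s => m * w.W s
  T₀ := (jointTypeClass_nonempty (w.sum_mul_W m)).choose
  γX := tableGamma w.GX w.g
  γY := tableGamma w.GY w.g
  γZ := tableGamma w.GZ w.g
  sum_Q := w.sum_mul_W m
  Q_supp := fun s hs => by rw [(w.valid_iff.1 hv).2.2.1 s hs, mul_zero]
  T₀_mem := (jointTypeClass_nonempty (w.sum_mul_W m)).choose_spec
  γZ_nonneg := tableGamma_nonneg w.GZ w.g
  γZ_le_one := tableGamma_le_one (w.valid_iff.1 hv).2.2.2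


/-! ## The closed form of the exponent at rational data -/

/-- The joint distribution `α = W/d`. [cite: VassilevskaWilliamsXuXuZhou2024, Prop. 5.1 (α)] -/
def alpha : Fin (2 * c + 1) × Fin (2 * c + 1) × Fin (2 * c + 1) → ℝ := fun s => (w.W s : ℝ) / w.total

/-- The penalty `P_α = max_{D(α)} H − H(α)` at `α = W/d`. [cite: VassilevskaWilliamsXuXuZhou2024, §5 (P_α)] -/
def penalty : ℝ := maxEntropyGivenMarginals (levelSupport (2 * c)) w.alpha - shannonEntropy w.alpha

/-- **Natural weights of `γ̄_Z = ∑ α(i,j,k) γ_{Z,i,j,k}`** as a distribution on pairs (level `k`, shape):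
`θ(k', σ) = ∑_{(i,j,k') : i+j+k'=2c} W(i,j,k') G_Z(i,j,k')(σ)`, total `d · g`. [cite: VassilevskaWilliamsXuXuZhou2024, §5 (preamble: γ̄_Z)] -/
def thetaWeights : Fin (2 * c + 1) × (Fin c → Fin 3) → ℕ := fun p =>
  ∑ x ∈ constituentTriples c, if x.2.2 = (p.1 : ℕ) then natTable w.W x * natTable w.GZ x p.2 else 0

/-- The index set `{0 < i ≤ 2c | 2c − k − i ≠ 0}` of `α(+,+,k) = ∑_{i,j>0} α(i, j, k)` (as in `alphaPP`). [cite: VassilevskaWilliamsXuXuZhou2024, §5 (preamble: α(+,+,k))] -/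
def ppIndex (c k : ℕ) : Finset ℕ := (range (2 * c + 1)).filter fun i => ¬ (i = 0 ∨ 2 * c - k - i = 0)

/-- **`W(+,+,k) = ∑_{i,j>0} W(i,j,k)`** (`α(+,+,k) = W(+,+,k)/d`). [cite: VassilevskaWilliamsXuXuZhou2024, §5 (preamble: α(+,+,k))] -/
def ppWeight (k : ℕ) : ℕ := ∑ i ∈ ppIndex c k, natTable w.W (i, 2 * c - k - i, k)

/-- **Natural weights of `γ̄_{Z,+,+,k}`**: `∑_{i,j>0} W(i,j,k) G_Z(i,j,k)(σ)`, total `g · W(+,+,k)`.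
[cite: VassilevskaWilliamsXuXuZhou2024, §5 (preamble: γ̄_{Z,+,+,k})] -/
def ppGammaWeights (k : ℕ) : (Fin c → Fin 3) → ℕ := fun σ =>
  ∑ i ∈ ppIndex c k, natTable w.W (i, 2 * c - k - i, k) * natTable w.GZ (i, 2 * c - k - i, k) σ

/-- The boundary constituent triples (`i = 0` or `j = 0`), whose classes keep their own `γ_Z` in `λ_Z`. [cite: VassilevskaWilliamsXuXuZhou2024, Def. 5.15 (1)] -/
def bdTriples (c : ℕ) : Finset (ℕ × ℕ × ℕ) := (constituentTriples c).filter fun ijk => ijk.1 = 0 ∨ ijk.2.1 = 0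

/-- **`λ_Z` at rational data**: `∑_{i=0 ∨ j=0} α(i,j,k) H(γ_{Z,i,j,k}) + ∑_k α(+,+,k) H(γ̄_{Z,+,+,k})` with
`α = W/d`, `γ_Z = G_Z/g`, `γ̄_{Z,+,+,k} = ppGammaWeights k / (g W(+,+,k))`. [cite: VassilevskaWilliamsXuXuZhou2024, §5 (preamble: λ_Z)] -/
def lambda : ℝ :=
  (∑ x ∈ bdTriples c, ((natTable w.W x : ℕ) : ℝ) / w.total *
      shannonEntropy (fun σ => ((natTable w.GZ x σ : ℕ) : ℝ) / w.g)) +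
    ∑ k ∈ range (2 * c + 1), (w.ppWeight k : ℝ) / w.total *
      shannonEntropy (fun σ => (w.ppGammaWeights k σ : ℝ) / ((w.g * w.ppWeight k : ℕ) : ℝ))

/-- **The exponent `E = min{H(α_X) − P_α, H(α_Y) − P_α, H(γ̄_Z) − λ_Z, H(α)}` of the region at the
rational data** (closed form; `= (w.datum hv m).exponent` for every `m ≥ 1`, `exponent_datum`).
[cite: VassilevskaWilliamsXuXuZhou2024, Prop. 5.1 (E₁) and Thm. 5.3] -/
def exponent : ℝ :=
  min (min (shannonEntropy (fun i => (margX w.W i : ℝ) / w.total) - w.penalty)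
        (shannonEntropy (fun j => (margY w.W j : ℝ) / w.total) - w.penalty))
    (min (shannonEntropy (fun p => (w.thetaWeights p : ℝ) / ((w.total * w.g : ℕ) : ℝ)) - w.lambda)
      (shannonEntropy w.alpha))

end RegionWeights

/-! ## `γ̄_Z` and `λ_Z` at an `α`-consistent triple, as sums over the constituent triples -/

section AlphaSums

variable {c n : ℕ}

/-- **`θ̄(k', σ) = ∑_{(i,j,k')} α(i,j,k') γ_{Z,i,j,k'}(σ)`** at an `α`-consistent triple (`n ≥ 1`).
[cite: VassilevskaWilliamsXuXuZhou2024, §5 (preamble: γ̄_Z = ∑ α(i,j,k) γ_{Z,i,j,k})] -/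
theorem targetPairDist_eq_sum_alpha {I J K : Fin n → ℕ} (h : IsLevelTriple c I J K) {α : ℕ × ℕ × ℕ → ℝ}
    (hα : IsAlphaConsistent α I J K) (hn : 0 < n) (γZ : ℕ × ℕ × ℕ → (Fin c → Fin 3) → ℝ)
    (p : Fin (2 * c + 1) × (Fin c → Fin 3)) :
    targetPairDist h γZ p = ∑ x ∈ constituentTriples c, if x.2.2 = (p.1 : ℕ) then α x * γZ x p.2 else 0 := by
  have hnR : (n : ℝ) ≠ 0 := by exact_mod_cast hn.ne'
  unfold targetPairDist
  rw [← Finset.sum_coe_sort (constituentTriples c)]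
  refine Fintype.sum_equiv (constituentTriples c).equivFin.symm _ _ fun s => ?_
  set x := (constituentTriples c).equivFin.symm s with hx
  have hs : s = (constituentTriples c).equivFin x := by rw [hx, Equiv.apply_symm_apply]
  have hfib : termFibre (tripleTermMap h) s = posClass I J K x.1.1 x.1.2.1 x.1.2.2 := by
    rw [hs]; exact termFibre_tripleTermMap_equivFin h x.2
  rw [hfib, hα]
  split_ifs
  · rw [mul_div_assoc, div_self hnR, mul_one]
  · rfl

/-- **`λ_Z = ∑_{i=0 ∨ j=0} α(i,j,k) H(γ_{Z,i,j,k}) + ∑_k α(+,+,k) H(γ̄_{Z,+,+,k})`** at an `α`-consistent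
triple (`n ≥ 1`) — the printed formula. [cite: VassilevskaWilliamsXuXuZhou2024, §5 (preamble: λ_Z) and Def. 5.15] -/
theorem targetLambda_eq_sum_alpha {I J K : Fin n → ℕ} (h : IsLevelTriple c I J K) {α : ℕ × ℕ × ℕ → ℝ}
    (hα : IsAlphaConsistent α I J K) (hn : 0 < n) (γZ : ℕ × ℕ × ℕ → (Fin c → Fin 3) → ℝ) :
    targetLambda h α γZ =
      (∑ x ∈ RegionWeights.bdTriples c, α x * shannonEntropy (γZ x)) +
        ∑ k ∈ range (2 * c + 1), alphaPP c α k * shannonEntropy (gammaBarZPP c α γZ k) := by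
  have hnR : (n : ℝ) ≠ 0 := by exact_mod_cast hn.ne'
  -- Step 1: as a sum over the coarse classes
  have step1 : targetLambda h α γZ = ∑ cl ∈ coarseClasses c,
      ((univ.filter fun t => coarseClassOf I J K t = cl).card : ℝ) / n * shannonEntropy (coarseGamma c α γZ cl) := by
    unfold targetLambda
    rw [← Finset.sum_coe_sort (coarseClasses c)]
    refine Fintype.sum_equiv (coarseClasses c).equivFin.symm _ _ fun s => ?_
    dsimp only [termFibre]
    rw [filter_coarseTermMap_eq h s]
    rfl
  rw [step1, coarseClasses, Finset.sum_union, Finset.sum_image, Finset.sum_image]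
  · congr 1
    · refine Finset.sum_congr rfl fun x hx => ?_
      obtain ⟨i, j, k⟩ := x
      have hb : i = 0 ∨ j = 0 := (mem_filter.1 hx).2
      rw [filter_coarseClassOf_some hb, hα]
      simp only [coarseGamma]
      rw [mul_div_assoc, div_self hnR, mul_one]
    · refine Finset.sum_congr rfl fun k _ => ?_
      rw [filter_coarseClassOf_none, card_posClassPP_eq h hα k]
      simp only [coarseGamma]
      rw [mul_div_assoc, div_self hnR, mul_one]
  · intro k₁ _ k₂ _ hk
    simpa using hk
  · intro x _ y _ hxy
    simp only [Prod.mk.injEq, Option.some.injEq] at hxy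
    exact Prod.ext hxy.1.1 (Prod.ext hxy.1.2 hxy.2)
  · rw [Finset.disjoint_left]
    intro cl h1 h2
    obtain ⟨x, _, rfl⟩ := mem_image.1 h1
    obtain ⟨k, _, hk⟩ := mem_image.1 h2
    simp at hk

end AlphaSums

/-! ## The datum of rational data: its exponent is the closed form -/

namespace RegionWeights

variable {c : ℕ} (w : RegionWeights c) (hv : w.valid = true) {m : ℕ}

/-- `natTable (m · W) = m · natTable W`. [folklore] -/
theorem natTable_mul (W : Fin (2 * c + 1) × Fin (2 * c + 1) × Fin (2 * c + 1) → ℕ) (m : ℕ) (ijk : ℕ × ℕ × ℕ) :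
    natTable (fun s => m * W s) ijk = m * natTable W ijk := by
  unfold natTable
  split_ifs <;> simp

/-- `Q/n = W/d` for the datum (`m ≥ 1`). [folklore] -/
theorem datum_alpha (hm : 0 < m) :
    (fun s => ((w.datum hv m).Q s : ℝ) / ((m * w.total : ℕ) : ℝ)) = w.alpha := by
  have hmR : (m : ℝ) ≠ 0 := by exact_mod_cast hm.ne'
  funext s
  show ((m * w.W s : ℕ) : ℝ) / ((m * w.total : ℕ) : ℝ) = (w.W s : ℝ) / w.total
  push_cast
  rw [mul_div_mul_left _ _ hmR]

/-- `Q_X/n = W_X/d` for the datum. [folklore] -/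
theorem datum_margX (hm : 0 < m) :
    (fun i => ((∑ j, ∑ l, (w.datum hv m).Q (i, j, l) : ℕ) : ℝ) / ((m * w.total : ℕ) : ℝ)) =
      fun i => (margX w.W i : ℝ) / w.total := by
  have hmR : (m : ℝ) ≠ 0 := by exact_mod_cast hm.ne'
  funext i
  have : (∑ j, ∑ l, (w.datum hv m).Q (i, j, l)) = m * margX w.W i := by
    simp only [datum, margX, Finset.mul_sum]
  rw [this]
  push_cast
  rw [mul_div_mul_left _ _ hmR]

/-- `Q_Y/n = W_Y/d` for the datum. [folklore] -/
theorem datum_margY (hm : 0 < m) :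
    (fun j => ((∑ i, ∑ l, (w.datum hv m).Q (i, j, l) : ℕ) : ℝ) / ((m * w.total : ℕ) : ℝ)) =
      fun j => (margY w.W j : ℝ) / w.total := by
  have hmR : (m : ℝ) ≠ 0 := by exact_mod_cast hm.ne'
  funext j
  have : (∑ i, ∑ l, (w.datum hv m).Q (i, j, l)) = m * margY w.W j := by
    simp only [datum, margY, Finset.mul_sum]
  rw [this]
  push_cast
  rw [mul_div_mul_left _ _ hmR]

/-- `typeAlpha n Q = natTable W / d` for the datum. [folklore] -/
theorem datum_typeAlpha (hm : 0 < m) :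
    typeAlpha (m * w.total) (w.datum hv m).Q = fun ijk => ((natTable w.W ijk : ℕ) : ℝ) / w.total := by
  have hmR : (m : ℝ) ≠ 0 := by exact_mod_cast hm.ne'
  funext ijk
  rw [typeAlpha_eq_natTable]
  show ((natTable (fun s => m * w.W s) ijk : ℕ) : ℝ) / ((m * w.total : ℕ) : ℝ) = _
  rw [natTable_mul]
  push_cast
  rw [mul_div_mul_left _ _ hmR]

/-- **`H(γ̄_Z)` of the datum is the entropy of `thetaWeights / (d g)`.** [cite: VassilevskaWilliamsXuXuZhou2024, §5 (preamble: γ̄_Z)] -/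
theorem datum_targetPairDist (hm : 0 < m)
    (h : IsLevelTriple c (seqVal (w.datum hv m).T₀.1) (seqVal (w.datum hv m).T₀.2.1) (seqVal (w.datum hv m).T₀.2.2)) :
    targetPairDist h (w.datum hv m).γZ =
      fun p => (w.thetaWeights p : ℝ) / ((w.total * w.g : ℕ) : ℝ) := by
  obtain ⟨hd, hg, -, -⟩ := w.valid_iff.1 hv
  have hn : 0 < m * w.total := Nat.mul_pos hm hd
  have hdR : (w.total : ℝ) ≠ 0 := by exact_mod_cast hd.ne'
  have hgR : (w.g : ℝ) ≠ 0 := by exact_mod_cast hg.ne'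
  have hα := isAlphaConsistent_typeAlpha (w.datum hv m).T₀_mem
  funext p
  rw [targetPairDist_eq_sum_alpha h hα hn, datum_typeAlpha w hv hm, thetaWeights, Nat.cast_sum, Finset.sum_div]
  refine Finset.sum_congr rfl fun x _ => ?_
  show (if x.2.2 = (p.1 : ℕ) then ((natTable w.W x : ℕ) : ℝ) / w.total * (((natTable w.GZ x p.2 : ℕ) : ℝ) / w.g) else 0) = _
  split_ifs
  · push_cast
    field_simp
  · simp

/-- `α(+,+,k) = W(+,+,k)/d` for the datum. [folklore] -/
theorem datum_alphaPP (hm : 0 < m) (k : ℕ) :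
    alphaPP c (typeAlpha (m * w.total) (w.datum hv m).Q) k = (w.ppWeight k : ℝ) / w.total := by
  rw [datum_typeAlpha w hv hm, alphaPP, ppWeight, Nat.cast_sum, Finset.sum_div]
  rfl

/-- `γ̄_{Z,+,+,k} = ppGammaWeights k / (g W(+,+,k))` for the datum. [folklore] -/
theorem datum_gammaBarZPP (hm : 0 < m) (k : ℕ) :
    gammaBarZPP c (typeAlpha (m * w.total) (w.datum hv m).Q) (w.datum hv m).γZ k =
      fun σ => (w.ppGammaWeights k σ : ℝ) / ((w.g * w.ppWeight k : ℕ) : ℝ) := by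
  obtain ⟨hd, hg, -, -⟩ := w.valid_iff.1 hv
  have hdR : (w.total : ℝ) ≠ 0 := by exact_mod_cast hd.ne'
  have hgR : (w.g : ℝ) ≠ 0 := by exact_mod_cast hg.ne'
  funext σ
  have hnum : (∑ i ∈ ppIndex c k, typeAlpha (m * w.total) (w.datum hv m).Q (i, 2 * c - k - i, k) *
      (w.datum hv m).γZ (i, 2 * c - k - i, k) σ) = (w.ppGammaWeights k σ : ℝ) / (w.total * w.g) := by
    rw [datum_typeAlpha w hv hm, ppGammaWeights, Nat.cast_sum, Finset.sum_div]
    refine Finset.sum_congr rfl fun i _ => ?_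
    show ((natTable w.W (i, 2 * c - k - i, k) : ℕ) : ℝ) / w.total *
        (((natTable w.GZ (i, 2 * c - k - i, k) σ : ℕ) : ℝ) / w.g) = _
    push_cast
    field_simp
  unfold gammaBarZPP
  rw [show (range (2 * c + 1)).filter (fun i => ¬ (i = 0 ∨ 2 * c - k - i = 0)) = ppIndex c k from rfl, hnum,
    datum_alphaPP w hv hm]
  rcases Nat.eq_zero_or_pos (w.ppWeight k) with h0 | hpos
  · simp [h0]
  · have hP : (w.ppWeight k : ℝ) ≠ 0 := by exact_mod_cast hpos.ne'
    push_cast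
    field_simp

/-- **`λ_Z` of the datum is the closed form `w.lambda`.** [cite: VassilevskaWilliamsXuXuZhou2024, §5 (preamble: λ_Z)] -/
theorem datum_targetLambda (hm : 0 < m)
    (h : IsLevelTriple c (seqVal (w.datum hv m).T₀.1) (seqVal (w.datum hv m).T₀.2.1) (seqVal (w.datum hv m).T₀.2.2)) :
    targetLambda h (typeAlpha (m * w.total) (w.datum hv m).Q) (w.datum hv m).γZ = w.lambda := by
  obtain ⟨hd, -, -, -⟩ := w.valid_iff.1 hv
  have hn : 0 < m * w.total := Nat.mul_pos hm hd
  have hα := isAlphaConsistent_typeAlpha (w.datum hv m).T₀_mem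
  rw [targetLambda_eq_sum_alpha h hα hn, lambda]
  congr 1
  · refine Finset.sum_congr rfl fun x _ => ?_
    rw [datum_typeAlpha w hv hm]
    rfl
  · refine Finset.sum_congr rfl fun k _ => ?_
    rw [datum_gammaBarZPP w hv hm, datum_alphaPP w hv hm]

/-- **The exponent of the datum is the closed form**: `(w.datum hv m).exponent = w.exponent` for
every `m ≥ 1` (the exponent of Thm. 5.3 depends on the type only through `Q/n = α`). [cite: VassilevskaWilliamsXuXuZhou2024, Prop. 5.1 and Thm. 5.3] -/
theorem exponent_datum (hm : 0 < m) : (w.datum hv m).exponent = w.exponent := by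
  unfold RegionDatum.exponent
  rw [congrArg shannonEntropy (w.datum_margX hv hm), congrArg shannonEntropy (w.datum_margY hv hm),
    w.datum_alpha hv hm, w.datum_targetPairDist hv hm, w.datum_targetLambda hv hm]
  rfl

end RegionWeights

/-! ## The kernel certificate for a lower bound of the exponent -/

section Certificate

variable {c : ℕ}

/-- A table on `Fin (2c+1)` read on `ℕ` (zero out of range). [folklore] -/
def finTable {β : Type*} [Zero β] (u : Fin (2 * c + 1) → β) (k : ℕ) : β :=
  if h : k < 2 * c + 1 then u ⟨k, h⟩ else 0

/-- **Certificate data for `E ≥ E₀/B`** at rational region data: a common denominator `B`, integer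
numerators of lower bounds `hX, hY, hA, hT` for `B · H(α_X), B · H(α_Y), B · H(α), B · H(γ̄_Z)`, of
upper bounds `M` for `B · max_{D(α)} H` (with the positive rational dual multipliers `u_X, u_Y, u_Z`,
`λ = log u`), `ubd(i,j,k)` for `B · H(γ_{Z,i,j,k})` on the boundary classes, `upp(k)` for
`B · H(γ̄_{Z,+,+,k})`, `Λ` for `B · λ_Z`, and the claimed `E₀`. [cite: VassilevskaWilliamsXuXuZhou2024, §8 ("verify that the parameters satisfy all the constraints")] -/
structure ExponentCert (c : ℕ) where
  /-- common denominator -/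
  B : ℕ
  /-- `B · H(α_X) ≥ hX` -/
  hX : ℤ
  /-- `B · H(α_Y) ≥ hY` -/
  hY : ℤ
  /-- `B · H(α) ≥ hA` -/
  hA : ℤ
  /-- `B · H(γ̄_Z) ≥ hT` -/
  hT : ℤ
  /-- `B · max_{D(α)} H ≤ M` -/
  M : ℤ
  /-- `B · λ_Z ≤ Λ` -/
  Λ : ℤ
  /-- the certified exponent: `E ≥ E₀ / B` -/
  E₀ : ℤ
  /-- dual multipliers `u_X = e^{λ_X}` -/
  uX : Fin (2 * c + 1) → ℚ
  /-- dual multipliers `u_Y` -/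
  uY : Fin (2 * c + 1) → ℚ
  /-- dual multipliers `u_Z` -/
  uZ : Fin (2 * c + 1) → ℚ
  /-- `B · H(γ_{Z,i,j,k}) ≤ ubd(i,j,k)` on the boundary classes -/
  ubd : Fin (2 * c + 1) × Fin (2 * c + 1) × Fin (2 * c + 1) → ℤ
  /-- `B · H(γ̄_{Z,+,+,k}) ≤ upp(k)` -/
  upp : Fin (2 * c + 1) → ℤ

namespace RegionWeights

variable (w : RegionWeights c) (C : ExponentCert c)

/-- **The kernel check of the certificate** (closed by `decide +kernel` at numerals): validity of the
data, the five entropy / maximum-entropy certificates of `CertifiedEntropyNumerics`, the per-class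
upper bounds entering `λ_Z` with their weighted sum, and the four integer inequalities
`E₀ + M ≤ hX + hA`, `E₀ + M ≤ hY + hA`, `E₀ + Λ ≤ hT`, `E₀ ≤ hA`. [cite: VassilevskaWilliamsXuXuZhou2024, §8] -/
def check : Bool :=
  w.valid && decide (0 < C.B) &&
  entropyGeCheck (margX w.W) w.total C.hX C.B &&
  entropyGeCheck (margY w.W) w.total C.hY C.B &&
  entropyGeCheck w.W w.total C.hA C.B &&
  maxEntLeCheck (levelSupport (2 * c)) w.W w.total C.uX C.uY C.uZ C.M C.B &&
  entropyGeCheck w.thetaWeights (w.total * w.g) C.hT C.B &&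
  decide (∀ x ∈ bdTriples c, natTable w.W x = 0 ∨
    entropyLeCheck (natTable w.GZ x) w.g (natTable C.ubd x) C.B = true) &&
  decide (∀ k < 2 * c + 1, w.ppWeight k = 0 ∨
    entropyLeCheck (w.ppGammaWeights k) (w.g * w.ppWeight k) (finTable C.upp k) C.B = true) &&
  decide ((∑ x ∈ bdTriples c, ((natTable w.W x : ℕ) : ℤ) * natTable C.ubd x) +
      (∑ k ∈ range (2 * c + 1), (w.ppWeight k : ℤ) * finTable C.upp k) ≤ C.Λ * w.total) &&
  decide (C.E₀ + C.M ≤ C.hX + C.hA) && decide (C.E₀ + C.M ≤ C.hY + C.hA) &&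
  decide (C.E₀ + C.Λ ≤ C.hT) && decide (C.E₀ ≤ C.hA)

variable {w C}

/-- **`check` from its parts** (for large data each kernel evaluation is best run as its own
declaration; this lemma reassembles them). [folklore] -/
theorem check_of_parts (h0 : w.valid = true) (hB : 0 < C.B)
    (h1 : entropyGeCheck (margX w.W) w.total C.hX C.B = true)
    (h2 : entropyGeCheck (margY w.W) w.total C.hY C.B = true)
    (h3 : entropyGeCheck w.W w.total C.hA C.B = true)
    (h4 : maxEntLeCheck (levelSupport (2 * c)) w.W w.total C.uX C.uY C.uZ C.M C.B = true)
    (h5 : entropyGeCheck w.thetaWeights (w.total * w.g) C.hT C.B = true)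
    (h6 : ∀ x ∈ bdTriples c, natTable w.W x = 0 ∨
      entropyLeCheck (natTable w.GZ x) w.g (natTable C.ubd x) C.B = true)
    (h7 : ∀ k < 2 * c + 1, w.ppWeight k = 0 ∨
      entropyLeCheck (w.ppGammaWeights k) (w.g * w.ppWeight k) (finTable C.upp k) C.B = true)
    (h8 : (∑ x ∈ bdTriples c, ((natTable w.W x : ℕ) : ℤ) * natTable C.ubd x) +
      (∑ k ∈ range (2 * c + 1), (w.ppWeight k : ℤ) * finTable C.upp k) ≤ C.Λ * w.total)
    (h9 : C.E₀ + C.M ≤ C.hX + C.hA) (h10 : C.E₀ + C.M ≤ C.hY + C.hA) (h11 : C.E₀ + C.Λ ≤ C.hT)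
    (h12 : C.E₀ ≤ C.hA) : w.check C = true := by
  simp only [check, h0, h1, h2, h3, h4, h5, Bool.true_and, Bool.and_true, Bool.and_eq_true, decide_eq_true_eq]
  exact ⟨⟨⟨⟨⟨⟨⟨hB, h6⟩, h7⟩, h8⟩, h9⟩, h10⟩, h11⟩, h12⟩

/-- **`λ_Z ≤ Λ/B`** from the per-class certificates and the weighted integer sum. [cite: VassilevskaWilliamsXuXuZhou2024, §8] -/
theorem lambda_le_of_check (hd : 0 < w.total) (hB : 0 < C.B)
    (hbd : ∀ x ∈ bdTriples c, natTable w.W x = 0 ∨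
      entropyLeCheck (natTable w.GZ x) w.g (natTable C.ubd x) C.B = true)
    (hpp : ∀ k < 2 * c + 1, w.ppWeight k = 0 ∨
      entropyLeCheck (w.ppGammaWeights k) (w.g * w.ppWeight k) (finTable C.upp k) C.B = true)
    (hΛ : (∑ x ∈ bdTriples c, ((natTable w.W x : ℕ) : ℤ) * natTable C.ubd x) +
      (∑ k ∈ range (2 * c + 1), (w.ppWeight k : ℤ) * finTable C.upp k) ≤ C.Λ * w.total) :
    w.lambda ≤ (C.Λ : ℝ) / C.B := by
  have hdR : (0 : ℝ) < w.total := by exact_mod_cast hd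
  have hBR : (0 : ℝ) < C.B := by exact_mod_cast hB
  have hS1 : (∑ x ∈ bdTriples c, ((natTable w.W x : ℕ) : ℝ) / w.total *
        shannonEntropy (fun σ => ((natTable w.GZ x σ : ℕ) : ℝ) / w.g)) ≤
      ∑ x ∈ bdTriples c, ((natTable w.W x : ℕ) : ℝ) / w.total * (((natTable C.ubd x : ℤ) : ℝ) / C.B) := by
    refine Finset.sum_le_sum fun x hx => ?_
    rcases hbd x hx with h0 | hle
    · simp [h0]
    · exact mul_le_mul_of_nonneg_left (shannonEntropy_le_of_check hle) (by positivity)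
  have hS2 : (∑ k ∈ range (2 * c + 1), (w.ppWeight k : ℝ) / w.total *
        shannonEntropy (fun σ => (w.ppGammaWeights k σ : ℝ) / ((w.g * w.ppWeight k : ℕ) : ℝ))) ≤
      ∑ k ∈ range (2 * c + 1), (w.ppWeight k : ℝ) / w.total * (((finTable C.upp k : ℤ) : ℝ) / C.B) := by
    refine Finset.sum_le_sum fun k hk => ?_
    rcases hpp k (mem_range.1 hk) with h0 | hle
    · simp [h0]
    · exact mul_le_mul_of_nonneg_left (shannonEntropy_le_of_check hle) (by positivity)
  have hsum : (∑ x ∈ bdTriples c, ((natTable w.W x : ℕ) : ℝ) / w.total * (((natTable C.ubd x : ℤ) : ℝ) / C.B)) +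
        ∑ k ∈ range (2 * c + 1), (w.ppWeight k : ℝ) / w.total * (((finTable C.upp k : ℤ) : ℝ) / C.B) =
      (((∑ x ∈ bdTriples c, ((natTable w.W x : ℕ) : ℤ) * natTable C.ubd x) +
          ∑ k ∈ range (2 * c + 1), (w.ppWeight k : ℤ) * finTable C.upp k : ℤ) : ℝ) / (w.total * C.B) := by
    push_cast
    rw [add_div, Finset.sum_div, Finset.sum_div]
    congr 1
    · refine Finset.sum_congr rfl fun x _ => ?_
      field_simp
    · refine Finset.sum_congr rfl fun k _ => ?_
      field_simp
  have hint : (((∑ x ∈ bdTriples c, ((natTable w.W x : ℕ) : ℤ) * natTable C.ubd x) +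
      ∑ k ∈ range (2 * c + 1), (w.ppWeight k : ℤ) * finTable C.upp k : ℤ) : ℝ) ≤ (C.Λ : ℝ) * w.total := by
    exact_mod_cast hΛ
  calc w.lambda ≤ _ := add_le_add hS1 hS2
    _ = _ := hsum
    _ ≤ (C.Λ : ℝ) * w.total / (w.total * C.B) := div_le_div_of_nonneg_right hint (by positivity)
    _ = (C.Λ : ℝ) / C.B := by
        rw [mul_comm (w.total : ℝ), mul_div_mul_right _ _ hdR.ne']

/-- **Soundness of the certificate**: `check = true → E₀/B ≤ E` (the closed-form exponent of the
rational data, hence the exponent of every datum `w.datum hv m`). [cite: VassilevskaWilliamsXuXuZhou2024, §8 and Prop. 5.1] -/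
theorem le_exponent_of_check (h : w.check C = true) : (C.E₀ : ℝ) / C.B ≤ w.exponent := by
  simp only [check, Bool.and_eq_true, decide_eq_true_eq] at h
  obtain ⟨⟨⟨⟨⟨⟨⟨⟨⟨⟨⟨⟨⟨hv, hB⟩, cX⟩, cY⟩, cA⟩, cM⟩, cT⟩, cbd⟩, cpp⟩, cΛ⟩, i1⟩, i2⟩, i3⟩, i4⟩ := h
  obtain ⟨hd, -, -, -⟩ := w.valid_iff.1 hv
  have hBR : (0 : ℝ) < C.B := by exact_mod_cast hB
  have eX := (div_le_iff₀ hBR).1 (shannonEntropy_ge_of_check cX)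
  have eY := (div_le_iff₀ hBR).1 (shannonEntropy_ge_of_check cY)
  have eA := (div_le_iff₀ hBR).1 (shannonEntropy_ge_of_check cA)
  have eM := (le_div_iff₀ hBR).1 (maxEntropyGivenMarginals_le_of_check cM)
  have eT := (div_le_iff₀ hBR).1 (shannonEntropy_ge_of_check cT)
  have eΛ := (le_div_iff₀ hBR).1 (lambda_le_of_check hd hB cbd cpp cΛ)
  have j1 : (C.E₀ : ℝ) + C.M ≤ C.hX + C.hA := by exact_mod_cast i1
  have j2 : (C.E₀ : ℝ) + C.M ≤ C.hY + C.hA := by exact_mod_cast i2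
  have j3 : (C.E₀ : ℝ) + C.Λ ≤ C.hT := by exact_mod_cast i3
  have j4 : (C.E₀ : ℝ) ≤ C.hA := by exact_mod_cast i4
  unfold exponent penalty alpha
  refine le_min (le_min ?_ ?_) (le_min ?_ ?_) <;> rw [div_le_iff₀ hBR] <;> nlinarith

/-- The certified bound holds for every datum of the data. [cite: VassilevskaWilliamsXuXuZhou2024, Prop. 5.1 and §8] -/
theorem le_exponent_datum_of_check (h : w.check C = true) (hv : w.valid = true) {m : ℕ} (hm : 0 < m) :
    (C.E₀ : ℝ) / C.B ≤ (w.datum hv m).exponent := by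
  rw [exponent_datum w hv hm]
  exact le_exponent_of_check h

/-- `check = true → valid = true`. [folklore] -/
theorem valid_of_check (h : w.check C = true) : w.valid = true := by
  simp only [check, Bool.and_eq_true] at h
  exact h.1.1.1.1.1.1.1.1.1.1.1.1.1

end RegionWeights

/-- **Thm. 5.3 (one region) at certified rational data.**  If the certificate checks, then for
every `m ≥ 1` and `0 ≤ ε ≤ 1`, `((md+1)^{3^c|S₃|})^3` copies of `(CW_q^{⊗c})^{⊗ md}` degenerate
(by restriction) to `κ` copies of the level-`ℓ` `ε`-interface tensor of the datum `w.datum m`,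
with `log₂(κ+1) ≥ md · (E₀/B − epsLoss c ε) − thm53Err c (md)` — the input of the global stage of
Algorithm 1 with the printed exponent replaced by its certified rational lower bound. [cite: VassilevskaWilliamsXuXuZhou2024, Thm. 5.3 and §8] -/
theorem vxxz2024_thm53_certified (K : Type*) [CommSemiring K] (q : ℕ) {c : ℕ} (hc : 0 < c)
    {w : RegionWeights c} {C : ExponentCert c} (h : w.check C = true) {m : ℕ} (hm : 0 < m)
    {ε : ℝ} (hε0 : 0 ≤ ε) (hε1 : ε ≤ 1) :
    ∃ κ : ℕ,
      TensorRestrictsTo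
        (kroneckerTensor (unitTensor K (inputCopies c (m * w.total)))
          (kroneckerPow (kroneckerPow (Literature.Barriers.MatrixMultiplication.bigCwTensor K q) c) (m * w.total)))
        (kroneckerTensor (unitTensor K κ)
          (interfaceTensor K q (w.datum (RegionWeights.valid_of_check h) m).termMap
            (w.datum (RegionWeights.valid_of_check h) m).termList ε)) ∧
      ((m * w.total : ℕ) : ℝ) * ((C.E₀ : ℝ) / C.B - epsLoss c ε) - thm53Err c (m * w.total) ≤
        Real.logb 2 ((κ : ℝ) + 1) := by
  have hv := RegionWeights.valid_of_check h
  obtain ⟨hd, -, -, -⟩ := w.valid_iff.1 hv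
  have hn : 0 < m * w.total := Nat.mul_pos hm hd
  obtain ⟨κ, hres, hb⟩ := vxxz2024_thm53_regionDatum K q hc hn (w.datum hv m) hε0 hε1
  refine ⟨κ, hres, le_trans ?_ hb⟩
  have hE := RegionWeights.le_exponent_datum_of_check h hv hm
  have hnR : (0 : ℝ) ≤ ((m * w.total : ℕ) : ℝ) := by positivity
  nlinarith

end Certificate

/-! ## Test (kernel evaluation at `c = 1`) -/

section Test

open RegionWeights

/-- Toy data at `c = 1` (level 1, `q` arbitrary): weights `2` on the mixed triples `(0,1,1), (1,0,1),
(1,1,0)` and `1` on `(2,0,0), (0,2,0), (0,0,2)` (`d = 9`); the split "distributions" of a level-1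
index into one part are the point masses (`g = 1`). [folklore] -/
def toyWeights : RegionWeights 1 where
  W := fun s => if (s.1 : ℕ) + s.2.1 + s.2.2 = 2 then (if (s.1 : ℕ) = 2 ∨ (s.2.1 : ℕ) = 2 ∨ (s.2.2 : ℕ) = 2 then 1 else 2) else 0
  GX := fun s σ => if (σ 0 : ℕ) = (s.1 : ℕ) then 1 else 0
  GY := fun s σ => if (σ 0 : ℕ) = (s.2.1 : ℕ) then 1 else 0
  GZ := fun s σ => if (σ 0 : ℕ) = (s.2.2 : ℕ) then 1 else 0
  g := 1

/-- A (very loose) certificate for the toy data: `E ≥ −3` from `H(α_X), H(α_Y), H(α), H(γ̄_Z) ≥ 0`,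
`max_D H ≤ log₂ 6 ≤ 3` (multipliers `u = 1`), all class entropies `≤ 2`, `λ_Z ≤ 2`. [folklore] -/
def toyCert : ExponentCert 1 where
  B := 1
  hX := 0
  hY := 0
  hA := 0
  hT := 0
  M := 3
  Λ := 2
  E₀ := -3
  uX := fun _ => 1
  uY := fun _ => 1
  uZ := fun _ => 1
  ubd := fun _ => 2
  upp := fun _ => 2

/-- The toy certificate checks in the kernel. [folklore] -/
example : toyWeights.check toyCert = true := by decide +kernel

/-- Hence `E ≥ −3` for the toy region data, and Thm. 5.3 applies to its data at every size `9m`. [folklore] -/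
example : (-3 : ℝ) ≤ toyWeights.exponent := by
  have := RegionWeights.le_exponent_of_check (w := toyWeights) (C := toyCert) (by decide +kernel)
  norm_num [toyCert] at this
  exact this

end Test

end Literature.Computability.AlgebraicComplexity
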